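import Mathlib
import HarnessLib
import Summits.HubbardSuperconductivity.HubbardSuperconductivity.Theorems.KLProgrammeKLRegimeWickEffectiveActionLegDressing

/-!
# Route `KLProgramme` — ENGINE child (stmt-HubbardSuperconductivity-19918 / gen-6 successor), (E2-v10) leg-dress line: TWO-LEG SELECTION from the
# four conservation laws, for an ARBITRARY carrier (cell gate-hubbard-kl, seat hubbard-kl-k3c2-p3 g3, row «leg-dress bar»; abstracts p1 g9's
# `kernel_klWickAction_two_plus/minus_eq_zero` (carrier `𝒲_n`) and my `kernel_klEffectiveAction_two_plus/minus_eq_zero` (carrier `𝒱_n`) so that a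
# third carrier — the continuous route's real-cutoff `W_Λ` (k3c1-p1 g6), or a slice-smeared vertex `e^{Δ_g}𝒱` — gets the hypotheses of
# `vertexFn_dblFold_oneLine_of_twoLeg` from its conservation laws in one line)

For `W : HubbardGrassmann L M` write the four laws as signed-sum vanishing statements (the shape of `…WickConservation` §4):
charge `Σ_i ±1 ≠ 0 ⇒ kernel = 0`, frequency `Σ_i ±n(ω_i) ≠ 0 ⇒ 0`, spin `Σ_{i:σ_i=↑} ±1 ≠ 0 ⇒ 0`, momentum `Σ_i ±k⃗_i(j) ≠ 0 ⇒ 0`.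
Then `kernel W 2 (ψ̂⁺_{pσ}, Y′) = 0` unless `Y′ = ψ̂⁻_{pσ}` (`kernel_two_plus_eq_zero_of_conservation`) and the mirror statement
(`kernel_two_minus_eq_zero_of_conservation`); whence **`vertexFn_dblFold_oneLine_of_conservation`**: the exact leg-dressing identity for any
even `W` obeying the four laws.  Proved; no definitions.
-/

noncomputable section

namespace Summit.HubbardSuperconductivity.HubbardSuperconductivity.Theorems.KLRegimeWick

set_option linter.dupNamespace false -- summit = problem name (single-conjunct summit), D-0017

open Literature.MathematicalPhysics.QuantumLattice GrassmannAlgebra Finset Matrix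
open Literature.Probability.LatticeModels
open Summit.HubbardSuperconductivity.HubbardSuperconductivity.Theorems.TwoPointAssembly
open Summit.HubbardSuperconductivity.HubbardSuperconductivity.Theorems.KLProgrammeLegKernels
open Summit.HubbardSuperconductivity.HubbardSuperconductivity.Theorems.KLRegimeSplit

section Generic

variable {L M : ℕ} [NeZero L] (β : ℝ)

omit [NeZero L] in
/-- **Two-leg selection from the conservation laws** (`ψ̂⁺` first): if the kernels of `W` vanish whenever the signed charge, frequency, spin or a
momentum coordinate does not balance, then `kernel W 2 (ψ̂⁺_{pσ}, Y′) = 0` unless `Y′ = ψ̂⁻_{pσ}`. -/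
theorem kernel_two_plus_eq_zero_of_conservation (W : HubbardGrassmann L M)
    (hcharge : ∀ {m : ℕ} {X : Fin m → HubbardFieldIdx L M}, (∑ i, (if (X i).2 = 0 then (1 : ℤ) else -1)) ≠ 0 → kernel ℂ W m X = 0)
    (hfreq : ∀ {m : ℕ} {X : Fin m → HubbardFieldIdx L M},
      (∑ i, (if (X i).2 = 0 then (1 : ℤ) else -1) * matsubaraInt M (X i).1.1.1) ≠ 0 → kernel ℂ W m X = 0)
    (hspin : ∀ {m : ℕ} {X : Fin m → HubbardFieldIdx L M},
      (∑ i, (if (X i).2 = 0 then (1 : ℤ) else -1) * (if (X i).1.2 = 0 then 1 else 0)) ≠ 0 → kernel ℂ W m X = 0)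
    (hmom : ∀ {m : ℕ} {X : Fin m → HubbardFieldIdx L M} (j : Fin 2),
      (∑ i, (if (X i).2 = 0 then (1 : ℤ) else -1) • (X i).1.1.2 j) ≠ 0 → kernel ℂ W m X = 0)
    (p : FreqMomentum L M) (σ : Fin 2) {Y' : HubbardFieldIdx L M} (hY : Y' ≠ ((p, σ), 1)) :
    kernel ℂ W 2 ![((p, σ), 0), Y'] = 0 := by
  rcases Y' with ⟨⟨p', σ'⟩, c'⟩
  by_cases hc : c' = 1
  · subst hc
    by_cases hσ : σ' = σ
    · subst hσ
      by_cases hf : p'.1 = p.1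
      · have hm : p'.2 ≠ p.2 := fun h2 => hY (by rw [show p' = p from Prod.ext hf h2])
        have : ∃ j : Fin 2, p'.2 j ≠ p.2 j := by
          by_contra hall
          push Not at hall
          exact hm (funext hall)
        obtain ⟨j, hj⟩ := this
        refine hmom j ?_
        simp only [Fin.sum_univ_two, Matrix.cons_val_zero, Matrix.cons_val_one, Fin.isValue, if_true, one_ne_zero, if_false,
          one_smul, neg_smul]
        intro h0
        apply hj
        linear_combination -h0
      · refine hfreq ?_
        simp only [Fin.sum_univ_two, Matrix.cons_val_zero, Matrix.cons_val_one, Fin.isValue, if_true, one_ne_zero, if_false,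
          one_mul, neg_mul]
        intro h0
        apply hf
        apply matsubaraInt_injective M
        linarith
    · refine hspin ?_
      clear hcharge hfreq hmom hspin hY
      fin_cases σ <;> fin_cases σ' <;> simp [Fin.sum_univ_two] at hσ ⊢
  · obtain rfl : c' = 0 := by
      rcases Fin.exists_fin_two.mp ⟨c', rfl⟩ with h | h
      · exact h
      · exact absurd h hc
    refine hcharge ?_
    simp [Fin.sum_univ_two]

omit [NeZero L] in
/-- … and (`ψ̂⁻` first): `kernel W 2 (ψ̂⁻_{pσ}, Y′) = 0` unless `Y′ = ψ̂⁺_{pσ}`. -/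
theorem kernel_two_minus_eq_zero_of_conservation (W : HubbardGrassmann L M)
    (hcharge : ∀ {m : ℕ} {X : Fin m → HubbardFieldIdx L M}, (∑ i, (if (X i).2 = 0 then (1 : ℤ) else -1)) ≠ 0 → kernel ℂ W m X = 0)
    (hfreq : ∀ {m : ℕ} {X : Fin m → HubbardFieldIdx L M},
      (∑ i, (if (X i).2 = 0 then (1 : ℤ) else -1) * matsubaraInt M (X i).1.1.1) ≠ 0 → kernel ℂ W m X = 0)
    (hspin : ∀ {m : ℕ} {X : Fin m → HubbardFieldIdx L M},
      (∑ i, (if (X i).2 = 0 then (1 : ℤ) else -1) * (if (X i).1.2 = 0 then 1 else 0)) ≠ 0 → kernel ℂ W m X = 0)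
    (hmom : ∀ {m : ℕ} {X : Fin m → HubbardFieldIdx L M} (j : Fin 2),
      (∑ i, (if (X i).2 = 0 then (1 : ℤ) else -1) • (X i).1.1.2 j) ≠ 0 → kernel ℂ W m X = 0)
    (p : FreqMomentum L M) (σ : Fin 2) {Y' : HubbardFieldIdx L M} (hY : Y' ≠ ((p, σ), 0)) :
    kernel ℂ W 2 ![((p, σ), 1), Y'] = 0 := by
  rcases Y' with ⟨⟨p', σ'⟩, c'⟩
  by_cases hc : c' = 0
  · subst hc
    have h2 : (![((p', σ'), (0 : Fin 2)), ((p, σ), 1)] : Fin 2 → HubbardFieldIdx L M) = ![((p, σ), 1), ((p', σ'), 0)] ∘ Equiv.swap (0 : Fin 2) 1 := by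
      funext i; fin_cases i <;> rfl
    have h := kernel_two_plus_eq_zero_of_conservation W hcharge hfreq hspin hmom p' σ' (Y' := ((p, σ), 1)) (fun h => hY (by
      simp only [Prod.mk.injEq] at h
      rw [h.1.1, h.1.2]))
    rw [h2, kernel_comp_perm, Equiv.Perm.sign_swap (by decide)] at h
    simpa using h
  · obtain rfl : c' = 1 := by
      rcases Fin.exists_fin_two.mp ⟨c', rfl⟩ with h | h
      · exact absurd h hc
      · exact h
    refine hcharge ?_
    simp [Fin.sum_univ_two]

/-- **`vertexFn_dblFold_oneLine_of_conservation`** — the exact leg-dressing identity for ANY even carrier obeying the four conservation laws: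
`𝒱₄(dblFold(Δ_×(C)(W⁰·W¹)))(Z) = 2·(βL²)⁻¹·𝒱₄(W)(Z)·Σ_{i<4} ℓ(p_i)·selfEnergy(W)(p_i,σ_i)` for every diagonal line `C` (values `ℓ`). -/
theorem vertexFn_dblFold_oneLine_of_conservation (hβ : β ≠ 0) {C : Matrix (HubbardFieldIdx L M) (HubbardFieldIdx L M) ℂ}
    {ℓ : FreqMomentum L M → ℂ} (hC : contr ℂ C = diagContr L M ℓ) (W : HubbardGrassmann L M) (hW0 : W ∈ evenOdd ℂ 0)
    (hcharge : ∀ {m : ℕ} {X : Fin m → HubbardFieldIdx L M}, (∑ i, (if (X i).2 = 0 then (1 : ℤ) else -1)) ≠ 0 → kernel ℂ W m X = 0)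
    (hfreq : ∀ {m : ℕ} {X : Fin m → HubbardFieldIdx L M},
      (∑ i, (if (X i).2 = 0 then (1 : ℤ) else -1) * matsubaraInt M (X i).1.1.1) ≠ 0 → kernel ℂ W m X = 0)
    (hspin : ∀ {m : ℕ} {X : Fin m → HubbardFieldIdx L M},
      (∑ i, (if (X i).2 = 0 then (1 : ℤ) else -1) * (if (X i).1.2 = 0 then 1 else 0)) ≠ 0 → kernel ℂ W m X = 0)
    (hmom : ∀ {m : ℕ} {X : Fin m → HubbardFieldIdx L M} (j : Fin 2),
      (∑ i, (if (X i).2 = 0 then (1 : ℤ) else -1) • (X i).1.1.2 j) ≠ 0 → kernel ℂ W m X = 0)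
    (Z : Fin 4 → HubbardFieldIdx L M) :
    vertexFn L M β (dblFold ℂ (grassmannLaplacian ℂ (crossCov ℂ C) (dblCopy ℂ 0 W * dblCopy ℂ 1 W))) 4 Z =
      2 * (((β * (L : ℝ) ^ 2 : ℝ) : ℂ))⁻¹ * vertexFn L M β W 4 Z *
        ∑ i : Fin 4, ℓ (Z i).1.1 * selfEnergy L M β W (Z i).1.1 (Z i).1.2 :=
  vertexFn_dblFold_oneLine_of_twoLeg β hβ hC W hW0
    (fun p σ _ hY => kernel_two_plus_eq_zero_of_conservation W hcharge hfreq hspin hmom p σ hY)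
    (fun p σ _ hY => kernel_two_minus_eq_zero_of_conservation W hcharge hfreq hspin hmom p σ hY) Z

end Generic

end Summit.HubbardSuperconductivity.HubbardSuperconductivity.Theorems.KLRegimeWick

end
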